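import Summits.CriticalPhenomena.PercolationContinuityZ3.Theorems.Transplant.SkelFrmBParamsBridge0
import Summits.CriticalPhenomena.PercolationContinuityZ3.Theorems.Transplant.SkelFrmBChoiceLinks
import Summits.CriticalPhenomena.PercolationContinuityZ3.Theorems.Transplant.SkelFrm1Normalise
import HarnessLib

/-!
# N2 (frames-only node `SamePDropOfSkeletonFrm₁`, OPEN), (R) value layer — part ChoiceBridge0: **THE ROOT BRIDGE AT `AtQNQ`** —
# its orientation IS the long pair's (`sel_ori`), its clause, and THE BRIDGE EVENT `hbridge` WITH ITS READINGS `Qb Fb hQb hFb` (the `hlong_of_atQ3` twin)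

At the premise `AtQNQ` of the choices of record `NegB.choiceAtQ3 …` (Defs3 p349149), for a pair slot `Pv ⊇ KS.Px0 mk` (SkelFrmBParamsBridge0, p3-g17):
* §1 **`ori_bridge0_eq_oL`** — the root bridge pair `(MB0, nB0)` and the long pair `(M_L, n_L)` are both SELECTED pairs, so `FactsNS.sel_ori` (SkelFrm1Normalise)
  equates their orientation bits: the bridge step reads THE SAME MAP `φL` as the hop and the corridor ((R-41)(b): only N1's case `o_b = o_L` survives in N2);
  `sgQ_bridge0_eq_one` (served near sign `1`, `sgQ_sel_eq_one`); **`clauseB0_of_atQ3`** (`EqGeom G φL t MB0 nB0 ∧ |hB0| ≤ 10·nB0`, from `clauseP_of_atQ`),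
  `eqNumB0_of_atQ3` (ℤ shapes), **`ℓB0_ge_of_atQ3`** (`2·b0 + 27 ≤ ℓB0`), `B0_ok_of_atQ3` (`hB`);
* §2 **`bridge0Sets_of_atQ3`** — the readings `hQb`/`hFb` of `Qb c := pgramPrismFin G φL c nB0 hB0 (3ℓB0) RB0`, `Fb c := pgSideHalfW G φL c nB0 hB0 ℓB0 RB0 1 1`
  against the frame `KS.B0 mk g f` in the root frame `rootFrame φL t 1` (+ `hFZ`: the piece misses the zone at `M_u`), from p3-g9's `bridgeSets_same`;
* §3 **`hbridge0_of_atQ3`** — `∀ c, 1 − a³ < P_q(linkIn (Qb c) (O.merged.Λ c (Mu O.merged)) (Fb c))` for every `a ≥ δkit` (the skeletons take `a := κ.δr 0`):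
  `inputsExtraAt_of_atQ` at the pair, served sign `1`, map `φL` by §1, the cube `δI3 ≤ a³`, and the seed-level monotonicity `Λ c k ⊆ Λ c M_u` (Links);
  **`hbridge0K_of_atQ3`** — the same with the zone AT THE SEED LEVEL `k` ((R-42): the successor skeletons `rootLegAt_frmQ3K_fst/_snd`).
NON-VACUITY: every row here is DISCHARGED at `AtQNQ` (no residual hypothesis beyond `Px0 ⊆ Pv`, which stmt-g21's tuple `PxQ ⊇ Px0 ∪ PxF …` meets by `subset_union`).
builds on p205010 (kernel theorem, internal audit signed; external expert review pending) — nothing in this file uses p205010; NOTHING is claimed about the open node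
`SamePDropOfSkeletonFrm₁`.
Lane `prim-bschramm`, seat `prim-bschramm-p3` (gen 17; N2 design owner, (R) column owner); helper file (`--supports stmt-CriticalPhenomena-4575 --as helper`).
[cite: KozmaNitzan2024, §4 pp. 19–21 ((21)–(25): the inputs at every vertex), p. 28 ((32) at the root), Lemma 10 Step IV] [cite: MartineauTassion2017, §3.2 Lemma 3.5]
-/

noncomputable section

open scoped Classical

namespace Summit.CriticalPhenomena.PercolationContinuityZ3.Theorems.Transplant

open MeasureTheory Literature.Probability.Percolation Literature.Probability.LatticeModels SimpleGraph KNCells KNLevels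
open Literature.Barriers.CriticalPhenomena (graphBall)

namespace PlanarSkeletonFrm

open SkelConc (Consts)
open Skelφ (oriφ trφ rootFrame pgSideHalfW pgramPrismFin)
open Skelφ.StepI (DataN DataNS OutNS)
open ChainPlanar (BridgePrm BridgeOK)

namespace NegB

open Neg

section Bridge0

variable {κ : Consts} {V : Type} [DecidableEq V] [Countable V] {G : SimpleGraph V} [G.LocallyFinite] {Φ : PlanarSkeletonFrm G} {t : V} {p : unitInterval}
  {hC : Φ.CylSubcritical p} {gv fv : Neg.FSlot} {Pv : PSlot} {Sv : SSlot} {cv : CSlot} {bv : BSlot} {O : OutNS V} {q : unitInterval}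

/-! ## §1 Orientation, served sign, clause -/

/-- **THE ROOT BRIDGE READS THE LONG MAP**: `O.ori t MB0 nB0 = o_L` (both pairs are selected; `FactsNS.sel_ori`). [this work] -/
theorem ori_bridge0_eq_oL (hAt : (choiceAtQ3 κ Φ t p Pv gv fv Sv cv bv hC).AtQNQ O q) (mk : ℕ) :
    O.ori t (KS.MB0 κ Φ t p O.merged mk) (KS.nB0 κ Φ t p O.merged mk) = oL κ Φ t p O.D O.DT.toDataN O.ori (gOf κ Φ t p O gv) (fOf κ Φ t p O fv) :=
  Skelφ.StepI.OutNS.FactsNS.sel_ori hAt.1 _ _ _ _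

/-- **Hence the bridge pair's oriented map IS `φL`.** [folklore] -/
theorem oriφ_bridge0_eq_φL (hAt : (choiceAtQ3 κ Φ t p Pv gv fv Sv cv bv hC).AtQNQ O q) (mk : ℕ) :
    oriφ Φ.φ (O.ori t (KS.MB0 κ Φ t p O.merged mk) (KS.nB0 κ Φ t p O.merged mk)) = φL κ Φ t p O.D O.DT.toDataN O.ori (gOf κ Φ t p O gv) (fOf κ Φ t p O fv) := by
  rw [ori_bridge0_eq_oL hAt mk]; rfl

/-- **The served near sign at the root bridge pair is `1`** (both families). [folklore] -/
theorem sgQ_bridge0_eq_one (hAt : (choiceAtQ3 κ Φ t p Pv gv fv Sv cv bv hC).AtQNQ O q) (mk : ℕ) (fam : Fin 2) :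
    Skelφ.StepI.sgQ O.qd O.qdT O.ori t (KS.MB0 κ Φ t p O.merged mk) (KS.nB0 κ Φ t p O.merged mk) fam = 1 :=
  sgQ_sel_eq_one hAt _ _ fam

/-- **THE ROOT BRIDGE CLAUSE at `AtQNQ`**: the merged record's geometric clause at `(MB0, nB0)` for the map `φL`, and `|hB0| ≤ 10·nB0`. [this work] -/
theorem clauseB0_of_atQ3 (hAt : (choiceAtQ3 κ Φ t p Pv gv fv Sv cv bv hC).AtQNQ O q) (mk : ℕ) :
    O.merged.EqGeom G (φL κ Φ t p O.D O.DT.toDataN O.ori (gOf κ Φ t p O gv) (fOf κ Φ t p O fv)) t (KS.MB0 κ Φ t p O.merged mk) (KS.nB0 κ Φ t p O.merged mk) ∧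
      (KS.hB0 κ Φ t p O.merged mk).natAbs ≤ 10 * KS.nB0 κ Φ t p O.merged mk := by
  have h := clauseP_of_atQ hAt (KS.bridge0_adm κ Φ t p O.merged mk).1 (KS.bridge0_adm κ Φ t p O.merged mk).2
  rw [oriφ_bridge0_eq_φL hAt mk] at h
  exact h

/-- The root bridge pair's numeric facts (ℤ shapes): `MB0 < nB0`, `MB0 < ℓB0`, `|vB0| ≤ nB0`, the layer inequality. [folklore] -/
theorem eqNumB0_of_atQ3 (hAt : (choiceAtQ3 κ Φ t p Pv gv fv Sv cv bv hC).AtQNQ O q) (mk : ℕ) :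
    KS.MB0 κ Φ t p O.merged mk < KS.nB0 κ Φ t p O.merged mk ∧ KS.MB0 κ Φ t p O.merged mk < KS.ℓB0 κ Φ t p O.merged mk ∧
      |KS.vB0 κ Φ t p O.merged mk| ≤ (KS.nB0 κ Φ t p O.merged mk : ℤ) ∧
      ((KS.MB0 κ Φ t p O.merged mk : ℤ) + 1) * ((KS.nB0 κ Φ t p O.merged mk : ℤ) + |KS.hB0 κ Φ t p O.merged mk|) ≤
        (KS.nB0 κ Φ t p O.merged mk : ℤ) * ((KS.ℓB0 κ Φ t p O.merged mk : ℤ) + 1) :=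
  eqNumB_of_eqGeom t O.merged _ _ _ (clauseB0_of_atQ3 hAt mk).1

/-- **`2·b0 + 27 ≤ ℓB0` at `AtQNQ`** (so `3 ≤ ℓB0`, `27 ≤ ℓB0`). [folklore] -/
theorem ℓB0_ge_of_atQ3 (hAt : (choiceAtQ3 κ Φ t p Pv gv fv Sv cv bv hC).AtQNQ O q) (mk : ℕ) :
    2 * KS.b0 κ Φ t p O.merged mk + 27 ≤ KS.ℓB0 κ Φ t p O.merged mk :=
  KS.ℓB0_ge κ Φ t p O.merged mk _ (clauseB0_of_atQ3 hAt mk).1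

/-- **`hB` at `AtQNQ`**: the root bridge frame is admissible. [folklore] -/
theorem B0_ok_of_atQ3 (hAt : (choiceAtQ3 κ Φ t p Pv gv fv Sv cv bv hC).AtQNQ O q) (mk : ℕ) :
    BridgeOK (KS.B0 κ Φ t p O.merged mk (gOf κ Φ t p O gv) (fOf κ Φ t p O fv)) :=
  KS.B0_ok κ Φ t p O.merged mk _ _ (by have := ℓB0_ge_of_atQ3 hAt mk; omega)

/-- The zone at `M_u` lies in the cylinder of `φL` of radius `M_u` about its centre (nested fat seeds). [folklore] -/
theorem zone_subset_cyl_φL (hAt : (choiceAtQ3 κ Φ t p Pv gv fv Sv cv bv hC).AtQNQ O q) (c : V) :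
    (↑(O.merged.Λ c (Mu O.merged)) : Set V) ⊆ Skelφ.cyl (φL κ Φ t p O.D O.DT.toDataN O.ori (gOf κ Φ t p O gv) (fOf κ Φ t p O fv)) c (Mu O.merged) := by
  obtain ⟨-, -, -, -, hΛeq⟩ := Skelφ.StepI.OutO.FactsO.seed hAt.1.factsO
  have hM : O.merged.Λ c (Mu O.merged) = Skelφ.fatSeq Φ.frame hC c (Mu O.merged) := by
    have := congrFun (congrFun hΛeq c) (Mu O.merged); exact this
  unfold NegB.φL
  rw [Skelφ.cyl_oriφ, hM]
  exact Skelφ.fatSeq_subset_cyl Φ.frame hC c _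

/-! ## §2 The readings of the bridge sets against `KS.B0` -/

/-- **`hQb`, `hFb` (and `hFZ`) FOR THE ROOT BRIDGE**: with `Qb c := pgramPrismFin G φL c nB0 hB0 (3ℓB0) RB0` and `Fb c := pgSideHalfW G φL c nB0 hB0 ℓB0 RB0 1 1`,
every `w ∈ Qb c` is within `RB0` of `c` and reads in `rootFrame φL t 1` inside `rootFrame c ± B0.pr`; every `w ∈ Fb c` is in `Qb c` and reads inside
`rootFrame c + [B0.dlo, B0.dhi]`; and `Fb c` misses the zone `Λ c M_u`. [cite: KozmaNitzan2024, §4 Lemma 10 Step IV] -/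
theorem bridge0Sets_of_atQ3 (hAt : (choiceAtQ3 κ Φ t p Pv gv fv Sv cv bv hC).AtQNQ O q) (mk : ℕ) :
    (∀ c, ∀ w ∈ pgramPrismFin G (φL κ Φ t p O.D O.DT.toDataN O.ori (gOf κ Φ t p O gv) (fOf κ Φ t p O fv)) c (KS.nB0 κ Φ t p O.merged mk) (KS.hB0 κ Φ t p O.merged mk)
        (3 * KS.ℓB0 κ Φ t p O.merged mk) (KS.RB0 κ Φ t p O.merged mk),
      w ∈ graphBall G c (KS.RB0 κ Φ t p O.merged mk) ∧
        rootFrame (φL κ Φ t p O.D O.DT.toDataN O.ori (gOf κ Φ t p O gv) (fOf κ Φ t p O fv)) t 1 w ∈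
          Finset.Icc (rootFrame (φL κ Φ t p O.D O.DT.toDataN O.ori (gOf κ Φ t p O gv) (fOf κ Φ t p O fv)) t 1 c -
              (((KS.B0 κ Φ t p O.merged mk (gOf κ Φ t p O gv) (fOf κ Φ t p O fv)).pr : ℕ) : Site 2))
            (rootFrame (φL κ Φ t p O.D O.DT.toDataN O.ori (gOf κ Φ t p O gv) (fOf κ Φ t p O fv)) t 1 c +
              (((KS.B0 κ Φ t p O.merged mk (gOf κ Φ t p O gv) (fOf κ Φ t p O fv)).pr : ℕ) : Site 2))) ∧
    (∀ c, ∀ w ∈ pgSideHalfW G (φL κ Φ t p O.D O.DT.toDataN O.ori (gOf κ Φ t p O gv) (fOf κ Φ t p O fv)) c (KS.nB0 κ Φ t p O.merged mk) (KS.hB0 κ Φ t p O.merged mk)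
        (KS.ℓB0 κ Φ t p O.merged mk) (KS.RB0 κ Φ t p O.merged mk) 1 1,
      w ∈ pgramPrismFin G (φL κ Φ t p O.D O.DT.toDataN O.ori (gOf κ Φ t p O gv) (fOf κ Φ t p O fv)) c (KS.nB0 κ Φ t p O.merged mk) (KS.hB0 κ Φ t p O.merged mk)
          (3 * KS.ℓB0 κ Φ t p O.merged mk) (KS.RB0 κ Φ t p O.merged mk) ∧
        rootFrame (φL κ Φ t p O.D O.DT.toDataN O.ori (gOf κ Φ t p O gv) (fOf κ Φ t p O fv)) t 1 w ∈
          Finset.Icc (rootFrame (φL κ Φ t p O.D O.DT.toDataN O.ori (gOf κ Φ t p O gv) (fOf κ Φ t p O fv)) t 1 c +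
              (KS.B0 κ Φ t p O.merged mk (gOf κ Φ t p O gv) (fOf κ Φ t p O fv)).dlo)
            (rootFrame (φL κ Φ t p O.D O.DT.toDataN O.ori (gOf κ Φ t p O gv) (fOf κ Φ t p O fv)) t 1 c +
              (KS.B0 κ Φ t p O.merged mk (gOf κ Φ t p O gv) (fOf κ Φ t p O fv)).dhi)) ∧
    (∀ c, Disjoint (pgSideHalfW G (φL κ Φ t p O.D O.DT.toDataN O.ori (gOf κ Φ t p O gv) (fOf κ Φ t p O fv)) c (KS.nB0 κ Φ t p O.merged mk) (KS.hB0 κ Φ t p O.merged mk)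
        (KS.ℓB0 κ Φ t p O.merged mk) (KS.RB0 κ Φ t p O.merged mk) 1 1) (O.merged.Λ c (Mu O.merged))) := by
  have hnb : 1 ≤ KS.nB0 κ Φ t p O.merged mk := by have := (eqNumB0_of_atQ3 hAt mk).1; omega
  have hMz : Mu O.merged < KS.nB0 κ Φ t p O.merged mk := lt_of_le_of_lt (KS.MB0_floors κ Φ t p O.merged mk).2.2 (KS.RF2_0 κ Φ t p O.merged mk).2.1
  have hℓ0 : (0 : ℤ) ≤ (KS.ℓB0 κ Φ t p O.merged mk : ℤ) := by positivity
  have hdlo : (KS.B0 κ Φ t p O.merged mk (gOf κ Φ t p O gv) (fOf κ Φ t p O fv)).dlo ≤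
      Skelφ.pt (KS.nB0 κ Φ t p O.merged mk) (1 * KS.hB0 κ Φ t p O.merged mk + min 0 (1 * (KS.ℓB0 κ Φ t p O.merged mk : ℤ))) := by
    have e : min 0 (1 * (KS.ℓB0 κ Φ t p O.merged mk : ℤ)) = 0 := by rw [one_mul]; exact min_eq_left hℓ0
    rw [e, add_zero]; exact le_of_eq rfl
  have hdhi : Skelφ.pt (KS.nB0 κ Φ t p O.merged mk) (1 * KS.hB0 κ Φ t p O.merged mk + max 0 (1 * (KS.ℓB0 κ Φ t p O.merged mk : ℤ))) ≤
      (KS.B0 κ Φ t p O.merged mk (gOf κ Φ t p O gv) (fOf κ Φ t p O fv)).dhi := by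
    have e : max 0 (1 * (KS.ℓB0 κ Φ t p O.merged mk : ℤ)) = KS.ℓB0 κ Φ t p O.merged mk := by rw [one_mul]; exact max_eq_right hℓ0
    rw [e]; exact le_of_eq rfl
  have key := fun c => Skelφ.bridgeSets_same (G := G) (φ := φL κ Φ t p O.D O.DT.toDataN O.ori (gOf κ Φ t p O gv) (fOf κ Φ t p O fv)) t (σ := 1) (Or.inl rfl)
    (KS.B0 κ Φ t p O.merged mk (gOf κ Φ t p O gv) (fOf κ Φ t p O fv)) (c := c) hnb (h := KS.hB0 κ Φ t p O.merged mk) (ℓ := KS.ℓB0 κ Φ t p O.merged mk)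
    (Rb := KS.RB0 κ Φ t p O.merged mk) (τ := 1) (Or.inl rfl) le_rfl hdlo hdhi (zone_subset_cyl_φL hAt c) hMz
  exact ⟨fun c => (key c).1, fun c => (key c).2.1, fun c => (key c).2.2⟩

/-! ## §3 The bridge event -/

/-- **`hbridge` FOR THE ROOT BRIDGE, LITERAL SHAPE**: at `Pv ⊇ Px0 mk`, for every `a ≥ δkit` and every centre `c`,
`1 − a³ < P_q(linkIn (pgramPrismFin G φL c nB0 hB0 (3ℓB0) RB0) (O.merged.Λ c (Mu O.merged)) (pgSideHalfW G φL c nB0 hB0 ℓB0 RB0 1 1))` — the extra pair's served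
side half (near sign `1` by `sgQ_sel_eq_one`, map `φL` by `sel_ori`), at the cube accuracy, zone lifted from the seed level to `M_u`. [cite: KozmaNitzan2024, §4 pp. 19–21] -/
theorem hbridge0_of_atQ3 (hAt : (choiceAtQ3 κ Φ t p Pv gv fv Sv cv bv hC).AtQNQ O q) (h1 : Φ.types = {t}) (mk : ℕ)
    (hPx : (KS.Px0 mk κ Φ t p O.merged).1 ⊆ (Pv κ Φ t p O.merged).1) {a : ℝ} (ha : Neg.δkit κ Φ ≤ a) :
    ∀ c : V, 1 - a ^ 3 < (bondPercolation G q).real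
      (linkIn (↑(pgramPrismFin G (φL κ Φ t p O.D O.DT.toDataN O.ori (gOf κ Φ t p O gv) (fOf κ Φ t p O fv)) c (KS.nB0 κ Φ t p O.merged mk) (KS.hB0 κ Φ t p O.merged mk)
          (3 * KS.ℓB0 κ Φ t p O.merged mk) (KS.RB0 κ Φ t p O.merged mk)) : Set V)
        (O.merged.Λ c (Mu O.merged))
        (pgSideHalfW G (φL κ Φ t p O.D O.DT.toDataN O.ori (gOf κ Φ t p O gv) (fOf κ Φ t p O fv)) c (KS.nB0 κ Φ t p O.merged mk) (KS.hB0 κ Φ t p O.merged mk)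
          (KS.ℓB0 κ Φ t p O.merged mk) (KS.RB0 κ Φ t p O.merged mk) 1 1)) := by
  intro c
  have h := inputsExtraAt_of_atQ hAt h1 c (KS.mem_of_Px0_subset κ Φ t p O.merged mk Pv hPx) 0 1
  rw [oriφ_bridge0_eq_φL hAt mk, sgQ_bridge0_eq_one hAt mk 0, Skelφ.StepI.eventNAt_some] at h
  unfold Skelφ.StepI.regionNAt Skelφ.StepI.pieceNAt at h
  rw [if_pos rfl, Units.val_one] at h
  rw [Skelφ.StepI.coe_pgramPrismFin]
  have hcube := δI3_le_cube_of_le κ Φ ha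
  refine lt_of_le_of_lt (by linarith) (h.trans_le (measureReal_mono ?_ (measure_ne_top _ _)))
  exact linkIn_mono le_rfl (zone_k_subset_zone_Mu hAt c) subset_rfl

/-- **`hbridge` FOR THE ROOT BRIDGE, zone AT THE SEED LEVEL `k`** ((R-42): the successor skeletons `…Q3K…` wire the fat seed at level `k`; Step I‴ serves
the link there natively — this is `hbridge0_of_atQ3` without the `M_u` lift). [cite: KozmaNitzan2024, §4 pp. 19–21] -/
theorem hbridge0K_of_atQ3 (hAt : (choiceAtQ3 κ Φ t p Pv gv fv Sv cv bv hC).AtQNQ O q) (h1 : Φ.types = {t}) (mk : ℕ)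
    (hPx : (KS.Px0 mk κ Φ t p O.merged).1 ⊆ (Pv κ Φ t p O.merged).1) {a : ℝ} (ha : Neg.δkit κ Φ ≤ a) :
    ∀ c : V, 1 - a ^ 3 < (bondPercolation G q).real
      (linkIn (↑(pgramPrismFin G (φL κ Φ t p O.D O.DT.toDataN O.ori (gOf κ Φ t p O gv) (fOf κ Φ t p O fv)) c (KS.nB0 κ Φ t p O.merged mk) (KS.hB0 κ Φ t p O.merged mk)
          (3 * KS.ℓB0 κ Φ t p O.merged mk) (KS.RB0 κ Φ t p O.merged mk)) : Set V)
        (O.merged.Λ c O.merged.k)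
        (pgSideHalfW G (φL κ Φ t p O.D O.DT.toDataN O.ori (gOf κ Φ t p O gv) (fOf κ Φ t p O fv)) c (KS.nB0 κ Φ t p O.merged mk) (KS.hB0 κ Φ t p O.merged mk)
          (KS.ℓB0 κ Φ t p O.merged mk) (KS.RB0 κ Φ t p O.merged mk) 1 1)) := by
  intro c
  have h := inputsExtraAt_of_atQ hAt h1 c (KS.mem_of_Px0_subset κ Φ t p O.merged mk Pv hPx) 0 1
  rw [oriφ_bridge0_eq_φL hAt mk, sgQ_bridge0_eq_one hAt mk 0, Skelφ.StepI.eventNAt_some] at h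
  unfold Skelφ.StepI.regionNAt Skelφ.StepI.pieceNAt at h
  rw [if_pos rfl, Units.val_one] at h
  rw [Skelφ.StepI.coe_pgramPrismFin]
  have hcube := δI3_le_cube_of_le κ Φ ha
  exact lt_of_le_of_lt (by linarith) h

/-- **`hbridge` at level `k` at the root accuracy `κ.δr 0`** (the `…Q3K…` skeletons' literal binder). [folklore] -/
theorem hbridge0K_of_atQ3_δr (hAt : (choiceAtQ3 κ Φ t p Pv gv fv Sv cv bv hC).AtQNQ O q) (h1 : Φ.types = {t}) (mk : ℕ)
    (hPx : (KS.Px0 mk κ Φ t p O.merged).1 ⊆ (Pv κ Φ t p O.merged).1) :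
    ∀ c : V, 1 - κ.δr 0 ^ 3 < (bondPercolation G q).real
      (linkIn (↑(pgramPrismFin G (φL κ Φ t p O.D O.DT.toDataN O.ori (gOf κ Φ t p O gv) (fOf κ Φ t p O fv)) c (KS.nB0 κ Φ t p O.merged mk) (KS.hB0 κ Φ t p O.merged mk)
          (3 * KS.ℓB0 κ Φ t p O.merged mk) (KS.RB0 κ Φ t p O.merged mk)) : Set V)
        (O.merged.Λ c O.merged.k)
        (pgSideHalfW G (φL κ Φ t p O.D O.DT.toDataN O.ori (gOf κ Φ t p O gv) (fOf κ Φ t p O fv)) c (KS.nB0 κ Φ t p O.merged mk) (KS.hB0 κ Φ t p O.merged mk)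
          (KS.ℓB0 κ Φ t p O.merged mk) (KS.RB0 κ Φ t p O.merged mk) 1 1)) :=
  hbridge0K_of_atQ3 hAt h1 mk hPx (Neg.δkit_le_δr κ Φ (n := 0) (by norm_num))

/-- **`hbridge` at the root accuracy `κ.δr 0`** (the skeletons' literal binder: `1 − (κ.δr 0)³ < …`). [folklore] -/
theorem hbridge0_of_atQ3_δr (hAt : (choiceAtQ3 κ Φ t p Pv gv fv Sv cv bv hC).AtQNQ O q) (h1 : Φ.types = {t}) (mk : ℕ)
    (hPx : (KS.Px0 mk κ Φ t p O.merged).1 ⊆ (Pv κ Φ t p O.merged).1) :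
    ∀ c : V, 1 - κ.δr 0 ^ 3 < (bondPercolation G q).real
      (linkIn (↑(pgramPrismFin G (φL κ Φ t p O.D O.DT.toDataN O.ori (gOf κ Φ t p O gv) (fOf κ Φ t p O fv)) c (KS.nB0 κ Φ t p O.merged mk) (KS.hB0 κ Φ t p O.merged mk)
          (3 * KS.ℓB0 κ Φ t p O.merged mk) (KS.RB0 κ Φ t p O.merged mk)) : Set V)
        (O.merged.Λ c (Mu O.merged))
        (pgSideHalfW G (φL κ Φ t p O.D O.DT.toDataN O.ori (gOf κ Φ t p O gv) (fOf κ Φ t p O fv)) c (KS.nB0 κ Φ t p O.merged mk) (KS.hB0 κ Φ t p O.merged mk)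
          (KS.ℓB0 κ Φ t p O.merged mk) (KS.RB0 κ Φ t p O.merged mk) 1 1)) :=
  hbridge0_of_atQ3 hAt h1 mk hPx (Neg.δkit_le_δr κ Φ (n := 0) (by norm_num))

end Bridge0

end NegB

end PlanarSkeletonFrm

end Summit.CriticalPhenomena.PercolationContinuityZ3.Theorems.Transplant

end
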